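import Literature.Probability.LatticeModels.TorusBlockFourier
import Mathlib.Analysis.SpecialFunctions.Trigonometric.Bounds
import HarnessLib

/-!
# Block kernels on the finite torus: the infrared wing under a Gaussian-domination bound

For `M = b·m`, a real function `f` on the fine torus `(ℤ/Mℤ)²` whose cosine Fourier coefficients
`f̂ᶜ(p) = Σ_x f(x) Re χ_p(x)` are nonnegative and obey an INFRARED (Gaussian-domination) BOUND
`f̂ᶜ(p)² · E(p) ≤ C` for `p ≠ 0`, `E(p) = Σᵢ (1 - cos pᵢ)` the free dispersion
(`dispersion (latticeMomentum M p)`), the coarse `b`-block kernel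
`k(X) = Σ_{β x' = X, β y' = 0} f(x' - y')` on `(ℤ/mℤ)²` has a SMALL INFRARED WING: for every cosine
threshold `cos κ₀`, `0 < κ₀ ≤ π`,

  `Σ_{q ≠ 0, ∀ i : cos κ₀ < Re χ_q(eᵢ)} Σ_X k(X) Re χ_q(X) ≤ (4/π) · b⁴ · κ₀ · M · m · √(C/8)`

(`TorusBlock.sum_infrared_blockKernel_mul_re_torusChar_le`), i.e. after dividing by `m² k(0)` an
infrared wing `β = O(κ₀)` UNIFORMLY IN THE VOLUME. This is the kinematics of input (a) of the Lévy
log-bootstrap of route `HubbardSuperconductivity/LevyLogBootstrap` (crux `LevyTransport`): the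
reflection-positivity infrared bound on the RAW two-point function is converted into the smallness
of the infrared part of the BLOCK kernel's spectral measure. Ingredients, all elementary:

* `TorusBlock.shellSum_inv_norm_le` — the lattice sum `Σ_{0 < ‖s‖_∞ ≤ J} 1/‖s‖₂ ≤ 8J` on `ℤ²`
  (the `j`-th `ℓ^∞`-shell has `8j` points of Euclidean norm `≥ j`);
* `TorusBlock.eight_mul_valMinAbs_sq_le` / `TorusBlock.dispersion_latticeMomentum_ge` — the free
  dispersion dominates the squared distance to `0`: `E(p) ≥ (8/M²) Σᵢ |pᵢ|²`, `|pᵢ|` the balanced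
  representative (`ZMod.valMinAbs`), from `cos x ≤ 1 - (2/π²) x²` on `|x| ≤ π`;
* `TorusBlock.natAbs_valMinAbs_le_of_reduce_eq` / `TorusBlock.card_filter_reduce_le` — the `b^d`
  fine momenta `p ≡ q (mod m)` folding onto a coarse momentum `q` are at least as far from `0` as
  `q` is;
* `TorusBlock.abs_valMinAbs_lt_of_cos_lt` — `cos κ₀ < cos(2π qᵢ/m)` forces `|qᵢ| < κ₀ m/(2π)`;
* `TorusBlock.sum_blockKernel_mul_re_torusChar_le` (file `TorusBlockFourier`) — the coarse
  structure factor is at most `b^d` times the folded fine one.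

Sources: T. Kennedy, E. H. Lieb, B. S. Shastry, J. Stat. Phys. 53 (1988) 1019 (the infrared bound
and the lattice sums it is fed into); S. Friedli, Y. Velenik (2017) §10.4 (discrete Fourier
analysis); C. Berg, J. P. R. Christensen, P. Ressel (1984) Ch. 4 §3. No definition is introduced;
sorry-free. The SHARP form `TorusBlock.sum_infrared_blockKernel_mul_re_torusChar_le_sharp`
(section `Sharp`, for `2 ≤ b`, `κ₀ ≤ π`) weights only the ONE infrared lift of each coarse momentum
by `1/‖q‖` — the other lifts have `E ≥ 1 - cos((2π-κ₀)/b)` (`TorusBlock.dispersion_ge_of_far`,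
`TorusBlock.valMinAbs_eq_of_abs_eq`) — improving the leading constant `b⁴` to `b²`:
`≤ (4/π) b² κ₀ M m √(C/8) + b⁴ √(C/(1 - cos((2π-κ₀)/b))) ((κ₀m/π)² + 2κ₀m/π)`.
-/

noncomputable section

open Finset Complex
open scoped BigOperators ComplexConjugate Real

namespace Literature.Probability.LatticeModels

namespace TorusBlock

/-! ### A lattice sum on `ℤ²`: `Σ_{0 < ‖s‖_∞ ≤ J} 1/‖s‖₂ ≤ 8J` -/

/-- The `ℓ^∞`-box of radius `J` in `ℤ²` has `(2J+1)²` points. [folklore] -/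
theorem card_intBox (J : ℕ) :
    ((Icc (-(J : ℤ)) J) ×ˢ (Icc (-(J : ℤ)) J)).card = (2 * J + 1) ^ 2 := by
  rw [card_product, Int.card_Icc]
  have h : ((J : ℤ) + 1 - -(J : ℤ)).toNat = 2 * J + 1 := by
    have : (J : ℤ) + 1 - -(J : ℤ) = ((2 * J + 1 : ℕ) : ℤ) := by push_cast; ring
    rw [this, Int.toNat_natCast]
  rw [h]
  ring

/-- **The planar lattice sum `Σ_{0 < ‖s‖_∞ ≤ J} 1/‖s‖₂ ≤ 8J`.** Summing `1/√(s₁² + s₂²)` over the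
nonzero points of the box `[-J, J]² ⊂ ℤ²`: the `j`-th `ℓ^∞`-shell has `(2j+1)² - (2j-1)² = 8j` points,
each of Euclidean norm at least `j`, so it contributes at most `8`. (Kennedy–Lieb–Shastry-type
bookkeeping of the infrared region of a `1/|k|` bound in `d = 2`.) [folklore] -/
theorem shellSum_inv_norm_le (J : ℕ) :
    ∑ s ∈ ((Icc (-(J : ℤ)) J) ×ˢ (Icc (-(J : ℤ)) J)).erase (0, 0),
        1 / Real.sqrt (((s.1 : ℝ)) ^ 2 + ((s.2 : ℝ)) ^ 2) ≤ 8 * (J : ℝ) := by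
  induction J with
  | zero =>
    have hbox : ((Icc (-((0 : ℕ) : ℤ)) (0 : ℕ)) ×ˢ (Icc (-((0 : ℕ) : ℤ)) (0 : ℕ))) = {((0 : ℤ), (0 : ℤ))} := by
      ext s
      simp only [Nat.cast_zero, neg_zero, Icc_self, singleton_product_singleton, mem_singleton]
    rw [hbox, erase_singleton, sum_empty]
    simp
  | succ J ih =>
    set g : ℤ × ℤ → ℝ := fun s => 1 / Real.sqrt (((s.1 : ℝ)) ^ 2 + ((s.2 : ℝ)) ^ 2) with hg
    set B : ℕ → Finset (ℤ × ℤ) := fun J => (Icc (-(J : ℤ)) J) ×ˢ (Icc (-(J : ℤ)) J) with hB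
    have hg0 : ∀ s, 0 ≤ g s := fun s => by
      simp only [hg]
      positivity
    have hmono : B J ⊆ B (J + 1) := by
      simp only [hB]
      refine product_subset_product ?_ ?_ <;>
      · refine Icc_subset_Icc ?_ ?_ <;> push_cast <;> linarith
    have h0mem : ∀ K : ℕ, ((0 : ℤ), (0 : ℤ)) ∈ B K := fun K => by
      simp only [hB, mem_product, mem_Icc]
      refine ⟨⟨?_, ?_⟩, ⟨?_, ?_⟩⟩ <;> simp
    have hsub : (B J).erase (0, 0) ⊆ (B (J + 1)).erase (0, 0) := erase_subset_erase _ hmono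
    -- split the sum into the inner box and the outer shell
    rw [← sum_sdiff hsub]
    have hih : ∑ s ∈ (B J).erase (0, 0), g s ≤ 8 * (J : ℝ) := ih
    -- every shell term is at most `1/(J+1)`
    have hJ1 : (0 : ℝ) < (J : ℝ) + 1 := by positivity
    have hterm : ∀ s ∈ (B (J + 1)).erase (0, 0) \ (B J).erase (0, 0), g s ≤ 1 / ((J : ℝ) + 1) := by
      intro s hs
      rw [mem_sdiff, mem_erase, mem_erase, not_and] at hs
      obtain ⟨⟨hs0, -⟩, hnot⟩ := hs
      have hsJ : s ∉ B J := hnot hs0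
      have hbig : ((J : ℝ) + 1) ^ 2 ≤ ((s.1 : ℝ)) ^ 2 + ((s.2 : ℝ)) ^ 2 := by
        simp only [hB, mem_product, mem_Icc, not_and_or, not_le] at hsJ
        have hcase : (J : ℤ) + 1 ≤ |s.1| ∨ (J : ℤ) + 1 ≤ |s.2| := by
          rcases hsJ with (h | h) | (h | h)
          · left; rw [abs_of_neg (by omega)]; omega
          · left; rw [abs_of_pos (by omega)]; omega
          · right; rw [abs_of_neg (by omega)]; omega
          · right; rw [abs_of_pos (by omega)]; omega
        rcases hcase with h | h
        · have h' : (J : ℝ) + 1 ≤ |((s.1 : ℝ))| := by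
            rw [← Int.cast_abs]; exact_mod_cast h
          calc ((J : ℝ) + 1) ^ 2 ≤ |((s.1 : ℝ))| ^ 2 := pow_le_pow_left₀ hJ1.le h' 2
            _ = ((s.1 : ℝ)) ^ 2 := sq_abs _
            _ ≤ ((s.1 : ℝ)) ^ 2 + ((s.2 : ℝ)) ^ 2 := le_add_of_nonneg_right (sq_nonneg _)
        · have h' : (J : ℝ) + 1 ≤ |((s.2 : ℝ))| := by
            rw [← Int.cast_abs]; exact_mod_cast h
          calc ((J : ℝ) + 1) ^ 2 ≤ |((s.2 : ℝ))| ^ 2 := pow_le_pow_left₀ hJ1.le h' 2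
            _ = ((s.2 : ℝ)) ^ 2 := sq_abs _
            _ ≤ ((s.1 : ℝ)) ^ 2 + ((s.2 : ℝ)) ^ 2 := le_add_of_nonneg_left (sq_nonneg _)
      have hsqrt : (J : ℝ) + 1 ≤ Real.sqrt (((s.1 : ℝ)) ^ 2 + ((s.2 : ℝ)) ^ 2) := by
        rw [← Real.sqrt_sq hJ1.le]
        exact Real.sqrt_le_sqrt hbig
      simp only [hg]
      exact one_div_le_one_div_of_le hJ1 hsqrt
    -- the shell has `8(J+1)` points
    have hcard : ((B (J + 1)).erase (0, 0) \ (B J).erase (0, 0)).card = 8 * (J + 1) := by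
      rw [card_sdiff_of_subset hsub, card_erase_of_mem (h0mem (J + 1)), card_erase_of_mem (h0mem J)]
      have hJ' : (B J).card = (2 * J + 1) ^ 2 := card_intBox J
      have hJ1' : (B (J + 1)).card = (2 * (J + 1) + 1) ^ 2 := by
        have := card_intBox (J + 1)
        simp only [hB]
        push_cast at this ⊢
        exact this
      rw [hJ', hJ1']
      have h1 : 1 ≤ (2 * J + 1) ^ 2 := Nat.one_le_pow _ _ (by omega)
      have h2 : (2 * J + 1) ^ 2 ≤ (2 * (J + 1) + 1) ^ 2 := Nat.pow_le_pow_left (by omega) 2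
      have key : (2 * (J + 1) + 1) ^ 2 = (2 * J + 1) ^ 2 + 8 * (J + 1) := by ring
      omega
    have hshell : ∑ s ∈ (B (J + 1)).erase (0, 0) \ (B J).erase (0, 0), g s ≤ 8 := by
      calc ∑ s ∈ (B (J + 1)).erase (0, 0) \ (B J).erase (0, 0), g s
          ≤ ∑ _s ∈ (B (J + 1)).erase (0, 0) \ (B J).erase (0, 0), 1 / ((J : ℝ) + 1) :=
            sum_le_sum hterm
        _ = 8 := by
            rw [sum_const, hcard, nsmul_eq_mul]
            push_cast
            field_simp
    calc ∑ s ∈ (B (J + 1)).erase (0, 0) \ (B J).erase (0, 0), g s + ∑ s ∈ (B J).erase (0, 0), g s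
        ≤ 8 + 8 * (J : ℝ) := add_le_add hshell hih
      _ = 8 * ((J + 1 : ℕ) : ℝ) := by push_cast; ring

/-! ### The free dispersion dominates the squared balanced distance to `0` -/

section Dispersion

variable {L : ℕ} [NeZero L]

/-- `cos (2π z.val / L) = cos (2π z.valMinAbs / L)`: the angle of a residue does not depend on the
representative (`z.val = z.valMinAbs` or `z.valMinAbs + L`). [folklore] -/
theorem cos_val_eq_cos_valMinAbs (z : ZMod L) :
    Real.cos (2 * π * (z.val : ℝ) / L) = Real.cos (2 * π * (z.valMinAbs : ℝ) / L) := by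
  have hL : (L : ℝ) ≠ 0 := Nat.cast_ne_zero.2 (NeZero.ne L)
  have hval := ZMod.val_eq_ite_valMinAbs z
  split_ifs at hval with h
  · have h' : (z.val : ℤ) = z.valMinAbs := by simpa using hval
    have : (z.val : ℝ) = (z.valMinAbs : ℝ) := by exact_mod_cast h'
    rw [this]
  · have : (z.val : ℝ) = (z.valMinAbs : ℝ) + L := by exact_mod_cast hval
    rw [this, show 2 * π * ((z.valMinAbs : ℝ) + L) / L = 2 * π * (z.valMinAbs : ℝ) / L + 2 * π by
      field_simp, Real.cos_add_two_pi]

/-- The balanced representative has `|z.valMinAbs| ≤ L/2`, so its angle `2π z.valMinAbs / L` lies in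
`[-π, π]`. [folklore] -/
theorem abs_angle_valMinAbs_le (z : ZMod L) : |2 * π * (z.valMinAbs : ℝ) / L| ≤ π := by
  have hL : (0 : ℝ) < (L : ℝ) := Nat.cast_pos.2 (Nat.pos_of_ne_zero (NeZero.ne L))
  have hnat : z.valMinAbs.natAbs ≤ L / 2 := ZMod.natAbs_valMinAbs_le z
  have habs : |(z.valMinAbs : ℝ)| ≤ (L : ℝ) / 2 := by
    have h1 : (z.valMinAbs.natAbs : ℝ) ≤ ((L / 2 : ℕ) : ℝ) := by exact_mod_cast hnat
    have h2 : ((L / 2 : ℕ) : ℝ) ≤ (L : ℝ) / 2 := Nat.cast_div_le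
    have h3 : (z.valMinAbs.natAbs : ℝ) = |(z.valMinAbs : ℝ)| := by
      rw [Nat.cast_natAbs, Int.cast_abs]
    rw [← h3]; exact h1.trans h2
  rw [abs_div, abs_of_pos hL, div_le_iff₀ hL, abs_mul, abs_of_pos (by positivity : (0:ℝ) < 2 * π)]
  calc 2 * π * |(z.valMinAbs : ℝ)| ≤ 2 * π * ((L : ℝ) / 2) :=
        mul_le_mul_of_nonneg_left habs (by positivity)
    _ = π * L := by ring

/-- **`1 - cos (2π z/L) ≥ 8 z.valMinAbs² / L²`** for a residue `z ∈ ℤ/L`: the cosine bound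
`cos x ≤ 1 - (2/π²) x²` on `|x| ≤ π` (`Real.cos_le_one_sub_mul_cos_sq`) at the balanced angle.
[folklore] -/
theorem eight_mul_valMinAbs_sq_le (z : ZMod L) :
    8 * (z.valMinAbs : ℝ) ^ 2 / (L : ℝ) ^ 2 ≤ 1 - Real.cos (2 * π * (z.val : ℝ) / L) := by
  have hL : (L : ℝ) ≠ 0 := Nat.cast_ne_zero.2 (NeZero.ne L)
  rw [cos_val_eq_cos_valMinAbs z]
  have h := Real.cos_le_one_sub_mul_cos_sq (abs_angle_valMinAbs_le z)
  have hx : 2 / π ^ 2 * (2 * π * (z.valMinAbs : ℝ) / L) ^ 2 = 8 * (z.valMinAbs : ℝ) ^ 2 / (L : ℝ) ^ 2 := by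
    field_simp
    ring
  linarith

/-- **The free dispersion dominates the squared balanced distance to the origin**:
`E(p) = Σᵢ (1 - cos pᵢ) ≥ (8/L²) Σᵢ (pᵢ.valMinAbs)²` for every momentum `p` of the dual torus
`(ℤ/Lℤ)^d` (`pᵢ = 2π (p i).val / L`). [folklore] -/
theorem dispersion_latticeMomentum_ge {d : ℕ} (p : TorusSite d L) :
    8 * (∑ i, ((p i).valMinAbs : ℝ) ^ 2) / (L : ℝ) ^ 2 ≤ dispersion (latticeMomentum L p) := by
  unfold dispersion
  rw [mul_sum, sum_div]
  refine sum_le_sum fun i _ => ?_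
  exact eight_mul_valMinAbs_sq_le (p i)

end Dispersion

/-! ### Folding fine momenta: lifts are at least as far from `0`; there are at most `b^d` of them -/

section Lifts

variable {d b m M : ℕ} [NeZero M] [NeZero m]

/-- **A fine momentum is at least as far from `0` as its coarse reduction.** For `M = b·m`, a
residue `z ∈ ℤ/M` reducing to `a ∈ ℤ/m` (`z.val ≡ a.val (mod m)`) has balanced distance
`|z.valMinAbs| ≥ |a.valMinAbs|`: `min(z.val, M - z.val) ≥ min(a.val, m - a.val)` since
`z.val = a.val + r·m` with `0 ≤ r < b`. [folklore] -/
theorem natAbs_valMinAbs_le_of_reduce_eq (hM : M = b * m) (z : ZMod M) (a : ZMod m)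
    (h : ((z.val : ℕ) : ZMod m) = a) : a.valMinAbs.natAbs ≤ z.valMinAbs.natAbs := by
  rw [ZMod.valMinAbs_natAbs_eq_min, ZMod.valMinAbs_natAbs_eq_min]
  have hb : 0 < b := pos_of_eq_mul hM
  have hzlt : z.val < m * b := by rw [mul_comm, ← hM]; exact z.val_lt
  have ha : a.val = z.val % m := by rw [← h, ZMod.val_natCast]
  have hdecomp : m * (z.val / m) + z.val % m = z.val := Nat.div_add_mod z.val m
  have hr : z.val / m < b := Nat.div_lt_of_lt_mul hzlt
  have halt : z.val % m < m := Nat.mod_lt _ (Nat.pos_of_ne_zero (NeZero.ne m))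
  have hkey : m * (z.val / m) + m ≤ b * m := by
    calc m * (z.val / m) + m = m * (z.val / m + 1) := by ring
      _ ≤ m * b := Nat.mul_le_mul_left m hr
      _ = b * m := mul_comm _ _
  have hM' : M = b * m := hM
  generalize hP : m * (z.val / m) = P at hdecomp hkey
  generalize hQ : b * m = Q at hM' hkey
  rw [ha]
  omega

omit [NeZero m] in
/-- **At most `b^d` fine momenta fold onto a coarse one**: for `M = b·m` the momenta
`p ∈ (ℤ/Mℤ)^d` with `p mod m = q` number at most `b^d` (in each coordinate `z ↦ z.val / m` injects
the fibre into `{0, …, b-1}`; in fact exactly `b^d`). [folklore] -/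
theorem card_filter_reduce_le (hM : M = b * m) (q : TorusSite d m) :
    (univ.filter (fun p : TorusSite d M => (fun i => (((p i).val : ℕ) : ZMod m)) = q)).card ≤ b ^ d := by
  classical
  have hset : univ.filter (fun p : TorusSite d M => (fun i => (((p i).val : ℕ) : ZMod m)) = q) =
      Fintype.piFinset (fun i => univ.filter (fun z : ZMod M => ((z.val : ℕ) : ZMod m) = q i)) := by
    ext p
    simp only [mem_filter, mem_univ, true_and, Fintype.mem_piFinset, funext_iff]
  rw [hset, Fintype.card_piFinset]
  have hcoord : ∀ i : Fin d,
      (univ.filter (fun z : ZMod M => ((z.val : ℕ) : ZMod m) = q i)).card ≤ b := by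
    intro i
    have hzlt : ∀ z : ZMod M, z.val < m * b := fun z => by rw [mul_comm, ← hM]; exact z.val_lt
    calc (univ.filter (fun z : ZMod M => ((z.val : ℕ) : ZMod m) = q i)).card
        ≤ (range b).card := by
          refine card_le_card_of_injOn (fun z => z.val / m) (fun z _ => ?_) ?_
          · exact mem_coe.2 (mem_range.2 (Nat.div_lt_of_lt_mul (hzlt z)))
          · intro z hz z' hz' hzz'
            have hq : z.val % m = z'.val % m := by
              have h1 : ((z.val : ℕ) : ZMod m) = q i := (mem_filter.1 (mem_coe.1 hz)).2
              have h2 : ((z'.val : ℕ) : ZMod m) = q i := (mem_filter.1 (mem_coe.1 hz')).2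
              have := h1.trans h2.symm
              rwa [ZMod.natCast_eq_natCast_iff'] at this
            apply ZMod.val_injective M
            simp only at hzz'
            rw [← Nat.div_add_mod z.val m, ← Nat.div_add_mod z'.val m, hzz', hq]
      _ = b := card_range b
  calc ∏ i, (univ.filter (fun z : ZMod M => ((z.val : ℕ) : ZMod m) = q i)).card
      ≤ ∏ _i : Fin d, b := prod_le_prod' fun i _ => hcoord i
    _ = b ^ d := by rw [prod_const, card_univ, Fintype.card_fin]

omit [NeZero M] [NeZero m] in
/-- A lift of a nonzero coarse momentum is nonzero. [folklore] -/
theorem ne_zero_of_reduce_eq {q : TorusSite d m} (hq : q ≠ 0) {p : TorusSite d M}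
    (hp : (fun i => (((p i).val : ℕ) : ZMod m)) = q) : p ≠ 0 := by
  rintro rfl
  apply hq
  rw [← hp]
  funext i
  simp

end Lifts

/-! ### The infrared box: `cos κ₀ < cos(2π qᵢ/m)` forces `|qᵢ| < κ₀ m / (2π)` -/

section InfraredBox

variable {d m : ℕ} [NeZero m]

/-- `Re χ_q(eᵢ) = cos(2π qᵢ.val / m)` on a torus of side `m ≥ 2` (so that `(1 : ℤ/m).val = 1`).
[folklore] -/
theorem re_torusChar_single (hm : 2 ≤ m) (q : TorusSite d m) (i : Fin d) :
    (torusChar q (Pi.single i 1)).re = Real.cos (2 * π * ((q i).val : ℝ) / m) := by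
  haveI : Fact (1 < m) := ⟨hm⟩
  rw [torusChar_re, Finset.sum_eq_single i]
  · rw [Pi.single_eq_same, ZMod.val_one, Nat.cast_one, mul_one]
    rfl
  · intro j _ hj
    rw [Pi.single_eq_of_ne hj, ZMod.val_zero, Nat.cast_zero, mul_zero]
  · intro h; exact absurd (mem_univ i) h

/-- **Momenta of the infrared box are close to the origin**: if `cos κ₀ < Re χ_q(eᵢ)` with
`0 ≤ κ₀`, then `|qᵢ.valMinAbs| < κ₀ m / (2π)` (cosine is decreasing on `[0, π]` and the balanced
angle `2π qᵢ.valMinAbs / m` lies in `[-π, π]`). [folklore] -/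
theorem abs_valMinAbs_lt_of_cos_lt (hm : 2 ≤ m) {κ₀ : ℝ} (hκ₀ : 0 ≤ κ₀)
    (q : TorusSite d m) (i : Fin d) (h : Real.cos κ₀ < (torusChar q (Pi.single i 1)).re) :
    |((q i).valMinAbs : ℝ)| < κ₀ * m / (2 * π) := by
  have hm0 : (0 : ℝ) < (m : ℝ) := Nat.cast_pos.2 (by omega)
  rw [re_torusChar_single hm, cos_val_eq_cos_valMinAbs,
    ← Real.cos_abs (2 * π * ((q i).valMinAbs : ℝ) / m)] at h
  have hxπ : |2 * π * ((q i).valMinAbs : ℝ) / m| ≤ π := abs_angle_valMinAbs_le (q i)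
  have hlt : |2 * π * ((q i).valMinAbs : ℝ) / m| < κ₀ := by
    by_contra hge
    exact absurd (Real.cos_le_cos_of_nonneg_of_le_pi hκ₀ hxπ (not_lt.1 hge)) (not_le.2 h)
  rw [abs_div, abs_of_pos hm0, div_lt_iff₀ hm0, abs_mul,
    abs_of_pos (by positivity : (0:ℝ) < 2 * π)] at hlt
  rw [lt_div_iff₀ (by positivity : (0:ℝ) < 2 * π)]
  linarith

end InfraredBox

/-! ### The infrared wing of a block kernel under an infrared bound -/

section Wing

variable {b m M : ℕ} [NeZero M] [NeZero m]

omit [NeZero m] in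
/-- The balanced coordinates `s(q) = (q₀.valMinAbs, q₁.valMinAbs) ∈ ℤ²` of a coarse momentum: an
injection `(ℤ/mℤ)² ↪ ℤ²` (`ZMod.valMinAbs` is injective). [folklore] -/
theorem valMinAbs_pair_injective :
    Function.Injective (fun q : TorusSite 2 m => (((q 0).valMinAbs : ℤ), ((q 1).valMinAbs : ℤ))) := by
  intro q q' h
  simp only [Prod.mk.injEq, ZMod.valMinAbs_inj] at h
  funext i
  fin_cases i
  · exact h.1
  · exact h.2

omit [NeZero m] in
/-- `s(q) = (0, 0)` only for `q = 0`. [folklore] -/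
theorem valMinAbs_pair_ne_zero {q : TorusSite 2 m} (hq : q ≠ 0) :
    (((q 0).valMinAbs : ℤ), ((q 1).valMinAbs : ℤ)) ≠ (0, 0) := by
  intro h
  apply hq
  have h0 : ((0 : TorusSite 2 m) 0).valMinAbs = 0 ∧ ((0 : TorusSite 2 m) 1).valMinAbs = 0 := by
    simp [ZMod.valMinAbs_zero]
  apply valMinAbs_pair_injective
  simp only [Prod.mk.injEq] at h ⊢
  rw [h.1, h.2, h0.1, h0.2]
  exact ⟨rfl, rfl⟩

/-- **THE INFRARED WING OF A BLOCK KERNEL UNDER A GAUSSIAN-DOMINATION BOUND.** Let `M = b·m`,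
`m ≥ 2`, and let `f : (ℤ/Mℤ)² → ℝ` have nonnegative cosine Fourier coefficients
`f̂ᶜ(p) = Σ_x f(x) Re χ_p(x) ≥ 0` obeying the infrared bound `f̂ᶜ(p)² · E(p) ≤ C` for `p ≠ 0`
(`E = dispersion ∘ latticeMomentum M`, i.e. `f̂ᶜ(p) ≤ √(C/E(p)) ∝ 1/|p|`). Then for every
`0 < κ₀` the coarse `b`-block kernel `k(X) = Σ_{β x' = X, β y' = 0} f(x' - y')` satisfies
`Σ_{q ∈ IR} Σ_X k(X) Re χ_q(X) ≤ (4/π) b⁴ κ₀ M m √(C/8)`, where the INFRARED BOX `IR` is the set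
of coarse momenta `q ≠ 0` with `cos κ₀ < Re χ_q(eᵢ)` for both `i` — written, as in the Lévy
bootstrap (`TorusLevyKhintchine.levyMass_le_logBootstrap`), as the complement in `{q ≠ 0}` of the
ultraviolet set `{q ≠ 0 : ∃ i, Re χ_q(eᵢ) ≤ cos κ₀}`. Proof: fold (`sum_blockKernel_mul_re_torusChar_le`,
factor `b²`, at most `b²` lifts `p ≡ q (mod m)` each with `E(p) ≥ 8‖s(q)‖²/M²`, whence
`f̂ᶜ(p) ≤ M √(C/8)/‖s(q)‖`), then the planar lattice sum `Σ_{0<‖s‖_∞≤J} 1/‖s‖₂ ≤ 8J` with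
`J = ⌊κ₀ m/(2π)⌋`. After division by `m² k(0)` (`k(0) ≥ b²·f(0)`-type floors) this is a
VOLUME-UNIFORM bound `O(κ₀)` on the infrared wing `β` of the block Lévy bootstrap (route
`HubbardSuperconductivity/LevyLogBootstrap`, crux `LevyTransport`, input (a)). Kennedy–Lieb–Shastry
(1988) eqs. (17)–(19) (infrared region bookkeeping); Friedli–Velenik (2017) §10.4. [folklore] -/
theorem sum_infrared_blockKernel_mul_re_torusChar_le (hM : M = b * m) (hm : 2 ≤ m)
    (f : TorusSite 2 M → ℝ) {C κ₀ : ℝ} (hC : 0 ≤ C) (hκ₀ : 0 < κ₀)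
    (h0 : ∀ p : TorusSite 2 M, p ≠ 0 → 0 ≤ ∑ x : TorusSite 2 M, f x * (torusChar p x).re)
    (hIR : ∀ p : TorusSite 2 M, p ≠ 0 →
      (∑ x : TorusSite 2 M, f x * (torusChar p x).re) ^ 2 * dispersion (latticeMomentum M p) ≤ C) :
    ∑ q ∈ (univ.erase (0 : TorusSite 2 m)) \
        univ.filter (fun q : TorusSite 2 m => q ≠ 0 ∧
          ∃ i : Fin 2, (torusChar q (Pi.single i 1)).re ≤ Real.cos κ₀),
      ∑ X : TorusSite 2 m, (∑ x' : TorusSite 2 M, ∑ y' : TorusSite 2 M,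
        if (∀ i : Fin 2, (x' i).val / b = (X i).val) ∧ (∀ i : Fin 2, (y' i).val / b = 0)
        then f (x' - y') else 0) * (torusChar q X).re ≤
      4 / π * (b : ℝ) ^ 4 * κ₀ * M * m * Real.sqrt (C / 8) := by
  classical
  -- notation
  set IR : Finset (TorusSite 2 m) := (univ.erase (0 : TorusSite 2 m)) \
      univ.filter (fun q : TorusSite 2 m => q ≠ 0 ∧
        ∃ i : Fin 2, (torusChar q (Pi.single i 1)).re ≤ Real.cos κ₀) with hIRdef
  set Kc : TorusSite 2 M → ℝ := fun p => ∑ x : TorusSite 2 M, f x * (torusChar p x).re with hKc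
  set s : TorusSite 2 m → ℤ × ℤ := fun q => (((q 0).valMinAbs : ℤ), ((q 1).valMinAbs : ℤ)) with hs
  set N : TorusSite 2 m → ℝ := fun q => Real.sqrt ((((s q).1 : ℝ)) ^ 2 + (((s q).2 : ℝ)) ^ 2)
    with hN
  set R : ℝ := κ₀ * m / (2 * π) with hR
  set J : ℕ := ⌊R⌋₊ with hJ
  set A : ℝ := (M : ℝ) * Real.sqrt (C / 8) with hA
  have hRnn : 0 ≤ R := by rw [hR]; positivity
  have hMpos : (0 : ℝ) < (M : ℝ) := Nat.cast_pos.2 (Nat.pos_of_ne_zero (NeZero.ne M))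
  have hAnn : 0 ≤ A := by rw [hA]; positivity
  have hb : 0 < b := pos_of_eq_mul hM
  -- membership in the infrared box
  have hmemIR : ∀ q ∈ IR, q ≠ 0 ∧ ∀ i : Fin 2, Real.cos κ₀ < (torusChar q (Pi.single i 1)).re := by
    intro q hq
    rw [hIRdef, mem_sdiff, mem_erase, mem_filter] at hq
    obtain ⟨⟨hq0, -⟩, hnot⟩ := hq
    refine ⟨hq0, fun i => ?_⟩
    by_contra hle
    exact hnot ⟨mem_univ _, hq0, i, not_lt.1 hle⟩
  -- `N(q)² = Σᵢ (qᵢ.valMinAbs)²`, and `N(q) > 0` for `q ≠ 0`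
  have hNsq : ∀ q, N q ^ 2 = ∑ i : Fin 2, (((q i).valMinAbs : ℝ)) ^ 2 := by
    intro q
    rw [hN, Real.sq_sqrt (by positivity), Fin.sum_univ_two]
  have hNpos : ∀ q : TorusSite 2 m, q ≠ 0 → 0 < N q := by
    intro q hq
    have hex : ∃ i, q i ≠ 0 := by
      by_contra h
      apply hq
      funext i
      by_contra hi
      exact h ⟨i, hi⟩
    obtain ⟨i, hi⟩ := hex
    have hvi : ((q i).valMinAbs : ℝ) ≠ 0 := by
      exact_mod_cast (mt (ZMod.valMinAbs_eq_zero (q i)).1 hi)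
    have hsq : 0 < N q ^ 2 := by
      rw [hNsq]
      calc (0 : ℝ) < (((q i).valMinAbs : ℝ)) ^ 2 := by positivity
        _ ≤ ∑ j : Fin 2, (((q j).valMinAbs : ℝ)) ^ 2 :=
            single_le_sum (f := fun j : Fin 2 => (((q j).valMinAbs : ℝ)) ^ 2)
              (fun j _ => sq_nonneg _) (mem_univ i)
    have hN0 : 0 ≤ N q := Real.sqrt_nonneg _
    nlinarith [hsq, hN0]
  -- (1) every lift `p ≡ q (mod m)` of `q ≠ 0` has `f̂ᶜ(p) ≤ A / N(q)`
  have hlift : ∀ q : TorusSite 2 m, q ≠ 0 → ∀ p : TorusSite 2 M,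
      (fun i => (((p i).val : ℕ) : ZMod m)) = q → Kc p ≤ A / N q := by
    intro q hq p hp
    have hp0 : p ≠ 0 := ne_zero_of_reduce_eq hq hp
    have hNq := hNpos q hq
    have hE : 8 * N q ^ 2 / (M : ℝ) ^ 2 ≤ dispersion (latticeMomentum M p) := by
      refine le_trans ?_ (dispersion_latticeMomentum_ge p)
      rw [hNsq]
      refine div_le_div_of_nonneg_right ?_ (sq_nonneg _)
      refine mul_le_mul_of_nonneg_left (sum_le_sum fun i _ => ?_) (by norm_num)
      have hnat := natAbs_valMinAbs_le_of_reduce_eq hM (p i) (q i) (congrFun hp i)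
      have e1 : (((q i).valMinAbs : ℝ)) ^ 2 = (((q i).valMinAbs.natAbs : ℝ)) ^ 2 := by
        rw [Nat.cast_natAbs, Int.cast_abs, sq_abs]
      have e2 : (((p i).valMinAbs : ℝ)) ^ 2 = (((p i).valMinAbs.natAbs : ℝ)) ^ 2 := by
        rw [Nat.cast_natAbs, Int.cast_abs, sq_abs]
      rw [e1, e2]
      exact pow_le_pow_left₀ (Nat.cast_nonneg _) (by exact_mod_cast hnat) 2
    have h8pos : 0 < 8 * N q ^ 2 / (M : ℝ) ^ 2 := by positivity
    have hEpos : 0 < dispersion (latticeMomentum M p) := lt_of_lt_of_le h8pos hE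
    have hK0 : 0 ≤ Kc p := h0 p hp0
    have hK2 : Kc p ^ 2 ≤ C / dispersion (latticeMomentum M p) := by
      rw [le_div_iff₀ hEpos]
      exact hIR p hp0
    have hK2' : Kc p ^ 2 ≤ (A / N q) ^ 2 := by
      refine hK2.trans ?_
      have hsq : (A / N q) ^ 2 = C / (8 * N q ^ 2 / (M : ℝ) ^ 2) := by
        rw [hA, div_pow, mul_pow, Real.sq_sqrt (by positivity)]
        field_simp
      rw [hsq]
      exact div_le_div_of_nonneg_left hC h8pos hE
    calc Kc p = Real.sqrt (Kc p ^ 2) := (Real.sqrt_sq hK0).symm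
      _ ≤ Real.sqrt ((A / N q) ^ 2) := Real.sqrt_le_sqrt hK2'
      _ = A / N q := Real.sqrt_sq (by positivity)
  -- (2) per coarse momentum: fold and count the lifts
  have hq_bound : ∀ q ∈ IR, ∑ X : TorusSite 2 m, (∑ x' : TorusSite 2 M, ∑ y' : TorusSite 2 M,
        if (∀ i : Fin 2, (x' i).val / b = (X i).val) ∧ (∀ i : Fin 2, (y' i).val / b = 0)
        then f (x' - y') else 0) * (torusChar q X).re ≤
      (b : ℝ) ^ 2 * ((b : ℝ) ^ 2 * (A / N q)) := by
    intro q hq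
    obtain ⟨hq0, -⟩ := hmemIR q hq
    have hfold := sum_blockKernel_mul_re_torusChar_le (d := 2) hM f q
      (fun p hp => h0 p (ne_zero_of_reduce_eq hq0 hp))
    refine hfold.trans (mul_le_mul_of_nonneg_left ?_ (by positivity))
    have hnn : 0 ≤ A / N q := div_nonneg hAnn (hNpos q hq0).le
    calc ∑ p ∈ univ.filter (fun p : TorusSite 2 M => (fun i => (((p i).val : ℕ) : ZMod m)) = q), Kc p
        ≤ ∑ _p ∈ univ.filter (fun p : TorusSite 2 M => (fun i => (((p i).val : ℕ) : ZMod m)) = q),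
            A / N q := sum_le_sum fun p hp => hlift q hq0 p (mem_filter.1 hp).2
      _ = ((univ.filter (fun p : TorusSite 2 M =>
            (fun i => (((p i).val : ℕ) : ZMod m)) = q)).card : ℝ) * (A / N q) := by
          rw [sum_const, nsmul_eq_mul]
      _ ≤ (b : ℝ) ^ 2 * (A / N q) := by
          refine mul_le_mul_of_nonneg_right ?_ hnn
          exact_mod_cast card_filter_reduce_le (d := 2) hM q
  -- (3) the balanced coordinates inject `IR` into the punctured box of radius `J`
  have himg : IR.image s ⊆ ((Icc (-(J : ℤ)) J) ×ˢ (Icc (-(J : ℤ)) J)).erase (0, 0) := by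
    intro t ht
    obtain ⟨q, hq, rfl⟩ := mem_image.1 ht
    obtain ⟨hq0, hcos⟩ := hmemIR q hq
    rw [mem_erase]
    refine ⟨valMinAbs_pair_ne_zero hq0, ?_⟩
    have hcoord : ∀ i : Fin 2, ((q i).valMinAbs : ℤ) ∈ Icc (-(J : ℤ)) J := by
      intro i
      have hlt := abs_valMinAbs_lt_of_cos_lt hm hκ₀.le q i (hcos i)
      rw [← hR] at hlt
      have hJR : ((J : ℕ) : ℤ) = ⌊R⌋ := by rw [hJ]; exact Int.natCast_floor_eq_floor hRnn
      rw [mem_Icc, hJR, neg_le, Int.le_floor, Int.le_floor, Int.cast_neg]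
      constructor
      · linarith [neg_abs_le ((q i).valMinAbs : ℝ)]
      · linarith [le_abs_self ((q i).valMinAbs : ℝ)]
    exact mem_product.2 ⟨hcoord 0, hcoord 1⟩
  have hsumN : ∑ q ∈ IR, 1 / N q ≤ 8 * (J : ℝ) := by
    have hre : ∑ q ∈ IR, 1 / N q =
        ∑ t ∈ IR.image s, 1 / Real.sqrt (((t.1 : ℝ)) ^ 2 + ((t.2 : ℝ)) ^ 2) := by
      rw [sum_image fun q _ q' _ h => valMinAbs_pair_injective h]
    rw [hre]
    refine le_trans ?_ (shellSum_inv_norm_le J)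
    exact sum_le_sum_of_subset_of_nonneg himg fun t _ _ => by positivity
  have hJle : (J : ℝ) ≤ R := Nat.floor_le hRnn
  -- (4) assemble
  calc ∑ q ∈ IR, ∑ X : TorusSite 2 m, (∑ x' : TorusSite 2 M, ∑ y' : TorusSite 2 M,
          if (∀ i : Fin 2, (x' i).val / b = (X i).val) ∧ (∀ i : Fin 2, (y' i).val / b = 0)
          then f (x' - y') else 0) * (torusChar q X).re
      ≤ ∑ q ∈ IR, (b : ℝ) ^ 2 * ((b : ℝ) ^ 2 * (A / N q)) := sum_le_sum hq_bound
    _ = (b : ℝ) ^ 4 * A * ∑ q ∈ IR, 1 / N q := by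
        rw [mul_sum]
        refine sum_congr rfl fun q _ => ?_
        ring
    _ ≤ (b : ℝ) ^ 4 * A * (8 * (J : ℝ)) := mul_le_mul_of_nonneg_left hsumN (by positivity)
    _ ≤ (b : ℝ) ^ 4 * A * (8 * R) := by
        refine mul_le_mul_of_nonneg_left ?_ (by positivity)
        linarith
    _ = 4 / π * (b : ℝ) ^ 4 * κ₀ * M * m * Real.sqrt (C / 8) := by
        rw [hA, hR]
        field_simp
        ring

end Wing

/-! ### The sharper form: only ONE lift of each coarse momentum is infrared -/

section Sharp

variable {d b m M : ℕ} [NeZero M] [NeZero m]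

/-- **Lifts differ from the coarse balanced representative by a multiple of `m`.** For `M = b·m`
and `z ∈ ℤ/M` reducing to `a ∈ ℤ/m`, `z.valMinAbs = a.valMinAbs + m·k` for some integer `k`
(`z.val = m·⌊z.val/m⌋ + a.val`, and both balanced representatives differ from the `val`s by
multiples of `m`). [folklore] -/
theorem exists_valMinAbs_eq_add_mul (hM : M = b * m) (z : ZMod M) (a : ZMod m)
    (h : ((z.val : ℕ) : ZMod m) = a) : ∃ k : ℤ, z.valMinAbs = a.valMinAbs + (m : ℤ) * k := by
  have ha : a.val = z.val % m := by rw [← h, ZMod.val_natCast]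
  obtain ⟨Q, hdecomp⟩ : ∃ Q : ℤ, (z.val : ℤ) = (m : ℤ) * Q + (a.val : ℤ) :=
    ⟨((z.val / m : ℕ) : ℤ), by rw [ha]; exact_mod_cast (Nat.div_add_mod z.val m).symm⟩
  have hM' : ((M : ℕ) : ℤ) = (b : ℤ) * (m : ℤ) := by rw [hM]; push_cast; ring
  have hz := ZMod.val_eq_ite_valMinAbs z
  have hav := ZMod.val_eq_ite_valMinAbs a
  split_ifs at hz hav with h1 h2 h2
  · refine ⟨Q, ?_⟩
    push_cast at hz hav
    linarith
  · refine ⟨Q + 1, ?_⟩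
    push_cast at hz hav
    linarith
  · refine ⟨Q - b, ?_⟩
    rw [hM'] at hz
    push_cast at hz hav
    linarith
  · refine ⟨Q - b + 1, ?_⟩
    rw [hM'] at hz
    linarith

/-- **Dichotomy for the lifts of a coarse residue**: a lift `z` of `a` (`M = b·m`) is either the
INFRARED lift, `|z.valMinAbs| = |a.valMinAbs|`, or it is far from the origin,
`|z.valMinAbs| ≥ m - |a.valMinAbs|`. [folklore] -/
theorem abs_valMinAbs_eq_or_le (hM : M = b * m) (z : ZMod M) (a : ZMod m)
    (h : ((z.val : ℕ) : ZMod m) = a) :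
    |(z.valMinAbs : ℤ)| = |(a.valMinAbs : ℤ)| ∨ (m : ℤ) - |(a.valMinAbs : ℤ)| ≤ |(z.valMinAbs : ℤ)| := by
  obtain ⟨k, hk⟩ := exists_valMinAbs_eq_add_mul hM z a h
  by_cases hk0 : k = 0
  · left; rw [hk, hk0, mul_zero, add_zero]
  · right
    have hmk : (m : ℤ) ≤ |(m : ℤ) * k| := by
      rw [abs_mul, abs_of_nonneg (by positivity : (0:ℤ) ≤ m)]
      exact le_mul_of_one_le_right (by positivity) (Int.one_le_abs hk0)
    have htri : |(m : ℤ) * k| ≤ |z.valMinAbs| + |a.valMinAbs| := by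
      have : (m : ℤ) * k = z.valMinAbs - a.valMinAbs := by rw [hk]; ring
      rw [this]; exact abs_sub _ _
    linarith

/-- **The infrared lift is unique**: if two lifts `z, z'` of `a` both have
`|valMinAbs| = |a.valMinAbs|` and `|a.valMinAbs| < m/2`, then `z = z'`. (`z.valMinAbs = a.valMinAbs + mk`
with `|a.valMinAbs + mk| = |a.valMinAbs|` forces `k = 0`, as `k ≠ 0` would give
`2|a.valMinAbs| = m|k| ≥ m`.) [folklore] -/
theorem valMinAbs_eq_of_abs_eq (hM : M = b * m) (z : ZMod M) (a : ZMod m)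
    (h : ((z.val : ℕ) : ZMod m) = a) (habs : |(z.valMinAbs : ℤ)| = |(a.valMinAbs : ℤ)|)
    (hsmall : 2 * |(a.valMinAbs : ℤ)| < m) : z.valMinAbs = a.valMinAbs := by
  obtain ⟨k, hk⟩ := exists_valMinAbs_eq_add_mul hM z a h
  by_cases hk0 : k = 0
  · rw [hk, hk0, mul_zero, add_zero]
  · exfalso
    have hsq : (a.valMinAbs + (m : ℤ) * k) ^ 2 = a.valMinAbs ^ 2 := by
      rw [← hk, ← sq_abs, habs, sq_abs]
    have hprod : (m : ℤ) * k * (2 * a.valMinAbs + (m : ℤ) * k) = 0 := by linear_combination hsq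
    have hmk0 : (m : ℤ) * k ≠ 0 := mul_ne_zero (by exact_mod_cast NeZero.ne m) hk0
    have h2 : 2 * a.valMinAbs + (m : ℤ) * k = 0 := (mul_eq_zero.1 hprod).resolve_left hmk0
    have hmk : (m : ℤ) ≤ |(m : ℤ) * k| := by
      rw [abs_mul, abs_of_nonneg (by positivity : (0:ℤ) ≤ m)]
      exact le_mul_of_one_le_right (by positivity) (Int.one_le_abs hk0)
    have : |(m : ℤ) * k| = 2 * |a.valMinAbs| := by
      rw [show (m : ℤ) * k = -(2 * a.valMinAbs) by linarith, abs_neg, abs_mul, abs_two]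
    linarith

/-- **Non-infrared lifts have dispersion at least `1 - cos((2π - κ₀)/b)`.** If a coordinate `i` of the
lift `p` of `q` is far from the origin, `|pᵢ.valMinAbs| ≥ m - |qᵢ.valMinAbs|`, while
`|qᵢ.valMinAbs| < κ₀ m/(2π)` (`q` in the infrared box, `κ₀ ≤ π`), then the angle `2π|pᵢ.valMinAbs|/M`
lies in `[(2π - κ₀)/b, π]`, so `E(p) ≥ 1 - cos(2π pᵢ/M) ≥ 1 - cos((2π - κ₀)/b)`. [folklore] -/
theorem dispersion_ge_of_far (hM : M = b * m) {κ₀ : ℝ} (hκπ : κ₀ ≤ π) (p : TorusSite d M)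
    (q : TorusSite d m) (i : Fin d) (hfar : (m : ℤ) - |((q i).valMinAbs : ℤ)| ≤ |((p i).valMinAbs : ℤ)|)
    (hsmall : |((q i).valMinAbs : ℝ)| < κ₀ * m / (2 * π)) :
    1 - Real.cos ((2 * π - κ₀) / b) ≤ dispersion (latticeMomentum M p) := by
  have hb : 0 < b := pos_of_eq_mul hM
  have hbR : (0 : ℝ) < b := Nat.cast_pos.2 hb
  have hm0 : (0 : ℝ) < m := Nat.cast_pos.2 (Nat.pos_of_ne_zero (NeZero.ne m))
  have hM0 : (0 : ℝ) < M := Nat.cast_pos.2 (Nat.pos_of_ne_zero (NeZero.ne M))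
  have hMR : (M : ℝ) = b * m := by rw [hM]; push_cast; ring
  -- the `i`-th term alone
  have hterm : 1 - Real.cos ((2 * π - κ₀) / b) ≤ 1 - Real.cos (latticeMomentum M p i) := by
    show 1 - Real.cos ((2 * π - κ₀) / b) ≤ 1 - Real.cos (2 * π * (((p i).val : ℕ) : ℝ) / M)
    rw [cos_val_eq_cos_valMinAbs (p i), ← Real.cos_abs (2 * π * (((p i).valMinAbs : ℤ) : ℝ) / M)]
    have hyπ : |2 * π * (((p i).valMinAbs : ℤ) : ℝ) / M| ≤ π := abs_angle_valMinAbs_le (p i)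
    have hx0 : 0 ≤ (2 * π - κ₀) / b := div_nonneg (by linarith [Real.pi_pos]) hbR.le
    have hxy : (2 * π - κ₀) / b ≤ |2 * π * (((p i).valMinAbs : ℤ) : ℝ) / M| := by
      have hfarR : (m : ℝ) - |(((q i).valMinAbs : ℤ) : ℝ)| ≤ |(((p i).valMinAbs : ℤ) : ℝ)| := by
        have := hfar
        rw [← Int.cast_abs, ← Int.cast_abs]
        exact_mod_cast this
      rw [abs_div, abs_of_pos hM0, abs_mul, abs_of_pos (by positivity : (0:ℝ) < 2 * π), hMR,
        le_div_iff₀ (by positivity)]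
      have h1 : (2 * π - κ₀) * m ≤ 2 * π * ((m : ℝ) - |(((q i).valMinAbs : ℤ) : ℝ)|) := by
        rw [lt_div_iff₀ (by positivity)] at hsmall
        nlinarith
      calc (2 * π - κ₀) / b * ((b : ℝ) * m) = (2 * π - κ₀) * m := by field_simp
        _ ≤ 2 * π * ((m : ℝ) - |(((q i).valMinAbs : ℤ) : ℝ)|) := h1
        _ ≤ 2 * π * |(((p i).valMinAbs : ℤ) : ℝ)| := mul_le_mul_of_nonneg_left hfarR (by positivity)
    linarith [Real.cos_le_cos_of_nonneg_of_le_pi hx0 hyπ hxy]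
  refine hterm.trans ?_
  unfold dispersion
  exact single_le_sum (f := fun j => 1 - Real.cos (latticeMomentum M p j))
    (fun j _ => sub_nonneg.2 (Real.cos_le_one _)) (mem_univ i)

/-- **THE INFRARED WING OF A BLOCK KERNEL — sharp form (one infrared lift per coarse momentum).**
Same setting as `sum_infrared_blockKernel_mul_re_torusChar_le`, with `κ₀ ≤ π`: among the (at most
`b²`) fine momenta `p ≡ q (mod m)` folding onto an infrared coarse momentum `q`, exactly one is
infrared (`|pᵢ.valMinAbs| = |qᵢ.valMinAbs|` for both `i`; `valMinAbs_eq_of_abs_eq`) and it alone is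
weighted by `M √(C/8)/‖s(q)‖`; every other lift has `E(p) ≥ c_b = 1 - cos((2π - κ₀)/b) > 0`
(`dispersion_ge_of_far`), hence `f̂ᶜ(p) ≤ √(C/c_b)`. Summing over the infrared box
(`#IR ≤ (2J+1)² - 1`, `J = ⌊κ₀ m/(2π)⌋`):

  `Σ_{q ∈ IR} Σ_X k(X) Re χ_q(X) ≤ (4/π) b² κ₀ M m √(C/8) + b⁴ √(C/c_b) ((κ₀ m/π)² + 2 κ₀ m/π)`,

improving the leading constant of the coarse form by the factor `b²` (for `b = 2`, `C = 2`, after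
division by `m² k(0) ≥ 2m²`: `β ≤ 8κ₀/π + O(κ₀²) + O(κ₀/m)`). Kennedy–Lieb–Shastry (1988)
eqs. (17)–(19); Friedli–Velenik (2017) §10.4. [folklore] -/
theorem sum_infrared_blockKernel_mul_re_torusChar_le_sharp (hM : M = b * m) (hb2 : 2 ≤ b)
    (hm : 2 ≤ m) (f : TorusSite 2 M → ℝ) {C κ₀ : ℝ} (hC : 0 ≤ C) (hκ₀ : 0 < κ₀) (hκπ : κ₀ ≤ π)
    (h0 : ∀ p : TorusSite 2 M, p ≠ 0 → 0 ≤ ∑ x : TorusSite 2 M, f x * (torusChar p x).re)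
    (hIR : ∀ p : TorusSite 2 M, p ≠ 0 →
      (∑ x : TorusSite 2 M, f x * (torusChar p x).re) ^ 2 * dispersion (latticeMomentum M p) ≤ C) :
    ∑ q ∈ (univ.erase (0 : TorusSite 2 m)) \
        univ.filter (fun q : TorusSite 2 m => q ≠ 0 ∧
          ∃ i : Fin 2, (torusChar q (Pi.single i 1)).re ≤ Real.cos κ₀),
      ∑ X : TorusSite 2 m, (∑ x' : TorusSite 2 M, ∑ y' : TorusSite 2 M,
        if (∀ i : Fin 2, (x' i).val / b = (X i).val) ∧ (∀ i : Fin 2, (y' i).val / b = 0)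
        then f (x' - y') else 0) * (torusChar q X).re ≤
      4 / π * (b : ℝ) ^ 2 * κ₀ * M * m * Real.sqrt (C / 8) +
        (b : ℝ) ^ 4 * Real.sqrt (C / (1 - Real.cos ((2 * π - κ₀) / b))) *
          ((κ₀ * m / π) ^ 2 + 2 * (κ₀ * m / π)) := by
  classical
  -- notation (as in the coarse form)
  set IR : Finset (TorusSite 2 m) := (univ.erase (0 : TorusSite 2 m)) \
      univ.filter (fun q : TorusSite 2 m => q ≠ 0 ∧
        ∃ i : Fin 2, (torusChar q (Pi.single i 1)).re ≤ Real.cos κ₀) with hIRdef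
  set Kc : TorusSite 2 M → ℝ := fun p => ∑ x : TorusSite 2 M, f x * (torusChar p x).re with hKc
  set s : TorusSite 2 m → ℤ × ℤ := fun q => (((q 0).valMinAbs : ℤ), ((q 1).valMinAbs : ℤ)) with hs
  set N : TorusSite 2 m → ℝ := fun q => Real.sqrt ((((s q).1 : ℝ)) ^ 2 + (((s q).2 : ℝ)) ^ 2)
    with hN
  set R : ℝ := κ₀ * m / (2 * π) with hR
  set J : ℕ := ⌊R⌋₊ with hJ
  set A : ℝ := (M : ℝ) * Real.sqrt (C / 8) with hA
  set cb : ℝ := 1 - Real.cos ((2 * π - κ₀) / b) with hcb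
  set D : ℝ := Real.sqrt (C / cb) with hD
  have hRnn : 0 ≤ R := by rw [hR]; positivity
  have hMpos : (0 : ℝ) < (M : ℝ) := Nat.cast_pos.2 (Nat.pos_of_ne_zero (NeZero.ne M))
  have hAnn : 0 ≤ A := by rw [hA]; positivity
  have hb : 0 < b := pos_of_eq_mul hM
  have hbR : (0 : ℝ) < b := Nat.cast_pos.2 hb
  have hm0 : (0 : ℝ) < m := Nat.cast_pos.2 (by omega)
  -- `c_b > 0` (the angle `(2π - κ₀)/b` lies in `(0, π]` for `b ≥ 2`)
  have hx0 : 0 < (2 * π - κ₀) / b := div_pos (by linarith [Real.pi_pos]) hbR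
  have hxπ : (2 * π - κ₀) / b ≤ π := by
    rw [div_le_iff₀ hbR]
    have hb2R : (2 : ℝ) ≤ b := by exact_mod_cast hb2
    nlinarith [Real.pi_pos, hκ₀.le]
  have hcbpos : 0 < cb := by
    rw [hcb, sub_pos]
    calc Real.cos ((2 * π - κ₀) / b) < Real.cos 0 :=
          Real.cos_lt_cos_of_nonneg_of_le_pi le_rfl hxπ hx0
      _ = 1 := Real.cos_zero
  have hDnn : 0 ≤ D := Real.sqrt_nonneg _
  -- membership in the infrared box
  have hmemIR : ∀ q ∈ IR, q ≠ 0 ∧ ∀ i : Fin 2, Real.cos κ₀ < (torusChar q (Pi.single i 1)).re := by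
    intro q hq
    rw [hIRdef, mem_sdiff, mem_erase, mem_filter] at hq
    obtain ⟨⟨hq0, -⟩, hnot⟩ := hq
    refine ⟨hq0, fun i => ?_⟩
    by_contra hle
    exact hnot ⟨mem_univ _, hq0, i, not_lt.1 hle⟩
  have hsmallq : ∀ q ∈ IR, ∀ i : Fin 2, |(((q i).valMinAbs : ℤ) : ℝ)| < R := fun q hq i => by
    rw [hR]; exact abs_valMinAbs_lt_of_cos_lt hm hκ₀.le q i ((hmemIR q hq).2 i)
  have hRle : R ≤ (m : ℝ) / 2 := by
    rw [hR, div_le_div_iff₀ (by positivity) (by norm_num : (0:ℝ) < 2)]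
    nlinarith [Real.pi_pos, hm0]
  -- `N(q)² = Σᵢ (qᵢ.valMinAbs)²`, and `N(q) > 0` for `q ≠ 0`
  have hNsq : ∀ q, N q ^ 2 = ∑ i : Fin 2, (((q i).valMinAbs : ℝ)) ^ 2 := by
    intro q
    rw [hN, Real.sq_sqrt (by positivity), Fin.sum_univ_two]
  have hNpos : ∀ q : TorusSite 2 m, q ≠ 0 → 0 < N q := by
    intro q hq
    have hex : ∃ i, q i ≠ 0 := by
      by_contra h
      apply hq
      funext i
      by_contra hi
      exact h ⟨i, hi⟩
    obtain ⟨i, hi⟩ := hex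
    have hvi : ((q i).valMinAbs : ℝ) ≠ 0 := by
      exact_mod_cast (mt (ZMod.valMinAbs_eq_zero (q i)).1 hi)
    have hsq : 0 < N q ^ 2 := by
      rw [hNsq]
      calc (0 : ℝ) < (((q i).valMinAbs : ℝ)) ^ 2 := by positivity
        _ ≤ ∑ j : Fin 2, (((q j).valMinAbs : ℝ)) ^ 2 :=
            single_le_sum (f := fun j : Fin 2 => (((q j).valMinAbs : ℝ)) ^ 2)
              (fun j _ => sq_nonneg _) (mem_univ i)
    have hN0 : 0 ≤ N q := Real.sqrt_nonneg _
    nlinarith [hsq, hN0]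
  -- (1) every lift `p ≡ q (mod m)` of `q ≠ 0` has `f̂ᶜ(p) ≤ A / N(q)`
  have hlift : ∀ q : TorusSite 2 m, q ≠ 0 → ∀ p : TorusSite 2 M,
      (fun i => (((p i).val : ℕ) : ZMod m)) = q → Kc p ≤ A / N q := by
    intro q hq p hp
    have hp0 : p ≠ 0 := ne_zero_of_reduce_eq hq hp
    have hNq := hNpos q hq
    have hE : 8 * N q ^ 2 / (M : ℝ) ^ 2 ≤ dispersion (latticeMomentum M p) := by
      refine le_trans ?_ (dispersion_latticeMomentum_ge p)
      rw [hNsq]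
      refine div_le_div_of_nonneg_right ?_ (sq_nonneg _)
      refine mul_le_mul_of_nonneg_left (sum_le_sum fun i _ => ?_) (by norm_num)
      have hnat := natAbs_valMinAbs_le_of_reduce_eq hM (p i) (q i) (congrFun hp i)
      have e1 : (((q i).valMinAbs : ℝ)) ^ 2 = (((q i).valMinAbs.natAbs : ℝ)) ^ 2 := by
        rw [Nat.cast_natAbs, Int.cast_abs, sq_abs]
      have e2 : (((p i).valMinAbs : ℝ)) ^ 2 = (((p i).valMinAbs.natAbs : ℝ)) ^ 2 := by
        rw [Nat.cast_natAbs, Int.cast_abs, sq_abs]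
      rw [e1, e2]
      exact pow_le_pow_left₀ (Nat.cast_nonneg _) (by exact_mod_cast hnat) 2
    have h8pos : 0 < 8 * N q ^ 2 / (M : ℝ) ^ 2 := by positivity
    have hEpos : 0 < dispersion (latticeMomentum M p) := lt_of_lt_of_le h8pos hE
    have hK0 : 0 ≤ Kc p := h0 p hp0
    have hK2 : Kc p ^ 2 ≤ C / dispersion (latticeMomentum M p) := by
      rw [le_div_iff₀ hEpos]
      exact hIR p hp0
    have hK2' : Kc p ^ 2 ≤ (A / N q) ^ 2 := by
      refine hK2.trans ?_
      have hsq : (A / N q) ^ 2 = C / (8 * N q ^ 2 / (M : ℝ) ^ 2) := by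
        rw [hA, div_pow, mul_pow, Real.sq_sqrt (by positivity)]
        field_simp
      rw [hsq]
      exact div_le_div_of_nonneg_left hC h8pos hE
    calc Kc p = Real.sqrt (Kc p ^ 2) := (Real.sqrt_sq hK0).symm
      _ ≤ Real.sqrt ((A / N q) ^ 2) := Real.sqrt_le_sqrt hK2'
      _ = A / N q := Real.sqrt_sq (by positivity)
  -- (1') a NON-infrared lift of `q ∈ IR` has `f̂ᶜ(p) ≤ D`
  have hlift_far : ∀ q ∈ IR, ∀ p : TorusSite 2 M, (fun i => (((p i).val : ℕ) : ZMod m)) = q →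
      (∃ i : Fin 2, (m : ℤ) - |((q i).valMinAbs : ℤ)| ≤ |((p i).valMinAbs : ℤ)|) → Kc p ≤ D := by
    rintro q hq p hp ⟨i, hfar⟩
    obtain ⟨hq0, -⟩ := hmemIR q hq
    have hp0 : p ≠ 0 := ne_zero_of_reduce_eq hq0 hp
    have hsm : |(((q i).valMinAbs : ℤ) : ℝ)| < κ₀ * m / (2 * π) := by
      have := hsmallq q hq i; rwa [hR] at this
    have hE : cb ≤ dispersion (latticeMomentum M p) := by
      rw [hcb]; exact dispersion_ge_of_far hM hκπ p q i hfar hsm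
    have hEpos : 0 < dispersion (latticeMomentum M p) := lt_of_lt_of_le hcbpos hE
    have hK0 : 0 ≤ Kc p := h0 p hp0
    have hK2 : Kc p ^ 2 ≤ C / cb := by
      have h1 : Kc p ^ 2 ≤ C / dispersion (latticeMomentum M p) := by
        rw [le_div_iff₀ hEpos]; exact hIR p hp0
      exact h1.trans (div_le_div_of_nonneg_left hC hcbpos hE)
    calc Kc p = Real.sqrt (Kc p ^ 2) := (Real.sqrt_sq hK0).symm
      _ ≤ Real.sqrt (C / cb) := Real.sqrt_le_sqrt hK2
      _ = D := by rw [hD]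
  -- (2) per coarse momentum: fold, one infrared lift, the rest bounded by `D`
  have hq_bound : ∀ q ∈ IR, ∑ X : TorusSite 2 m, (∑ x' : TorusSite 2 M, ∑ y' : TorusSite 2 M,
        if (∀ i : Fin 2, (x' i).val / b = (X i).val) ∧ (∀ i : Fin 2, (y' i).val / b = 0)
        then f (x' - y') else 0) * (torusChar q X).re ≤
      (b : ℝ) ^ 2 * (A / N q + (b : ℝ) ^ 2 * D) := by
    intro q hq
    obtain ⟨hq0, -⟩ := hmemIR q hq
    have hfold := sum_blockKernel_mul_re_torusChar_le (d := 2) hM f q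
      (fun p hp => h0 p (ne_zero_of_reduce_eq hq0 hp))
    refine hfold.trans (mul_le_mul_of_nonneg_left ?_ (by positivity))
    set L : Finset (TorusSite 2 M) :=
      univ.filter (fun p : TorusSite 2 M => (fun i => (((p i).val : ℕ) : ZMod m)) = q) with hL
    set P : TorusSite 2 M → Prop := fun p =>
      ∀ i : Fin 2, |((p i).valMinAbs : ℤ)| = |((q i).valMinAbs : ℤ)| with hP
    have hmemL : ∀ p ∈ L, (fun i => (((p i).val : ℕ) : ZMod m)) = q := fun p hp =>
      (mem_filter.1 hp).2
    have hnnA : 0 ≤ A / N q := div_nonneg hAnn (hNpos q hq0).le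
    -- the infrared lifts: at most one
    have hinner_card : (L.filter P).card ≤ 1 := by
      refine card_le_one.2 fun p hp p' hp' => ?_
      rw [mem_filter] at hp hp'
      funext i
      have h2v : 2 * |((q i).valMinAbs : ℤ)| < m := by
        have hlt : |(((q i).valMinAbs : ℤ) : ℝ)| < (m : ℝ) / 2 := (hsmallq q hq i).trans_le hRle
        have : (2 : ℝ) * |(((q i).valMinAbs : ℤ) : ℝ)| < m := by linarith
        rw [← Int.cast_abs] at this
        exact_mod_cast this
      have e1 := valMinAbs_eq_of_abs_eq hM (p i) (q i) (congrFun (hmemL p hp.1) i) (hp.2 i) h2v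
      have e2 := valMinAbs_eq_of_abs_eq hM (p' i) (q i) (congrFun (hmemL p' hp'.1) i) (hp'.2 i) h2v
      exact ZMod.valMinAbs_inj.1 (e1.trans e2.symm)
    have hinner : ∑ p ∈ L.filter P, Kc p ≤ A / N q := by
      calc ∑ p ∈ L.filter P, Kc p ≤ ∑ _p ∈ L.filter P, A / N q :=
            sum_le_sum fun p hp => hlift q hq0 p (hmemL p (mem_filter.1 hp).1)
        _ = ((L.filter P).card : ℝ) * (A / N q) := by rw [sum_const, nsmul_eq_mul]
        _ ≤ 1 * (A / N q) := by
            refine mul_le_mul_of_nonneg_right ?_ hnnA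
            exact_mod_cast hinner_card
        _ = A / N q := one_mul _
    -- the other lifts: each bounded by `D`, at most `b²` of them
    have houter : ∑ p ∈ L.filter (fun p => ¬ P p), Kc p ≤ (b : ℝ) ^ 2 * D := by
      have hfar : ∀ p ∈ L.filter (fun p => ¬ P p), Kc p ≤ D := by
        intro p hp
        rw [mem_filter] at hp
        obtain ⟨hpL, hnP⟩ := hp
        have hex : ∃ i : Fin 2, (m : ℤ) - |((q i).valMinAbs : ℤ)| ≤ |((p i).valMinAbs : ℤ)| := by
          by_contra hnone
          apply hnP
          intro i
          rcases abs_valMinAbs_eq_or_le hM (p i) (q i) (congrFun (hmemL p hpL) i) with h | h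
          · exact h
          · exact absurd ⟨i, h⟩ hnone
        exact hlift_far q hq p (hmemL p hpL) hex
      calc ∑ p ∈ L.filter (fun p => ¬ P p), Kc p ≤ ∑ _p ∈ L.filter (fun p => ¬ P p), D :=
            sum_le_sum hfar
        _ = ((L.filter (fun p => ¬ P p)).card : ℝ) * D := by rw [sum_const, nsmul_eq_mul]
        _ ≤ (b : ℝ) ^ 2 * D := by
            refine mul_le_mul_of_nonneg_right ?_ hDnn
            have h1 : (L.filter (fun p => ¬ P p)).card ≤ L.card := card_filter_le _ _
            have h2 : L.card ≤ b ^ 2 := card_filter_reduce_le (d := 2) hM q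
            exact_mod_cast h1.trans h2
    calc ∑ p ∈ L, Kc p = ∑ p ∈ L.filter P, Kc p + ∑ p ∈ L.filter (fun p => ¬ P p), Kc p :=
          (sum_filter_add_sum_filter_not L P _).symm
      _ ≤ A / N q + (b : ℝ) ^ 2 * D := add_le_add hinner houter
  -- (3) the balanced coordinates inject `IR` into the punctured box of radius `J`
  have himg : IR.image s ⊆ ((Icc (-(J : ℤ)) J) ×ˢ (Icc (-(J : ℤ)) J)).erase (0, 0) := by
    intro t ht
    obtain ⟨q, hq, rfl⟩ := mem_image.1 ht
    obtain ⟨hq0, hcos⟩ := hmemIR q hq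
    rw [mem_erase]
    refine ⟨valMinAbs_pair_ne_zero hq0, ?_⟩
    have hcoord : ∀ i : Fin 2, ((q i).valMinAbs : ℤ) ∈ Icc (-(J : ℤ)) J := by
      intro i
      have hlt := abs_valMinAbs_lt_of_cos_lt hm hκ₀.le q i (hcos i)
      rw [← hR] at hlt
      have hJR : ((J : ℕ) : ℤ) = ⌊R⌋ := by rw [hJ]; exact Int.natCast_floor_eq_floor hRnn
      rw [mem_Icc, hJR, neg_le, Int.le_floor, Int.le_floor, Int.cast_neg]
      constructor
      · linarith [neg_abs_le ((q i).valMinAbs : ℝ)]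
      · linarith [le_abs_self ((q i).valMinAbs : ℝ)]
    exact mem_product.2 ⟨hcoord 0, hcoord 1⟩
  have hsumN : ∑ q ∈ IR, 1 / N q ≤ 8 * (J : ℝ) := by
    have hre : ∑ q ∈ IR, 1 / N q =
        ∑ t ∈ IR.image s, 1 / Real.sqrt (((t.1 : ℝ)) ^ 2 + ((t.2 : ℝ)) ^ 2) := by
      rw [sum_image fun q _ q' _ h => valMinAbs_pair_injective h]
    rw [hre]
    refine le_trans ?_ (shellSum_inv_norm_le J)
    exact sum_le_sum_of_subset_of_nonneg himg fun t _ _ => by positivity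
  have hcardIR : (IR.card : ℝ) ≤ (2 * (J : ℝ) + 1) ^ 2 - 1 := by
    have h1 : IR.card = (IR.image s).card :=
      (card_image_of_injective IR valMinAbs_pair_injective).symm
    have h2 : (IR.image s).card ≤ (((Icc (-(J : ℤ)) J) ×ˢ (Icc (-(J : ℤ)) J)).erase (0, 0)).card :=
      card_le_card himg
    have h0mem : ((0 : ℤ), (0 : ℤ)) ∈ (Icc (-(J : ℤ)) J) ×ˢ (Icc (-(J : ℤ)) J) := by
      simp only [mem_product, mem_Icc]
      refine ⟨⟨?_, ?_⟩, ⟨?_, ?_⟩⟩ <;> simp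
    rw [card_erase_of_mem h0mem, card_intBox] at h2
    have h3 : IR.card + 1 ≤ (2 * J + 1) ^ 2 := by
      have := Nat.one_le_pow 2 (2 * J + 1) (by omega)
      omega
    have h4 : ((IR.card + 1 : ℕ) : ℝ) ≤ (((2 * J + 1) ^ 2 : ℕ) : ℝ) := by exact_mod_cast h3
    push_cast at h4
    linarith
  have hJle : (J : ℝ) ≤ R := Nat.floor_le hRnn
  -- (4) assemble
  calc ∑ q ∈ IR, ∑ X : TorusSite 2 m, (∑ x' : TorusSite 2 M, ∑ y' : TorusSite 2 M,
          if (∀ i : Fin 2, (x' i).val / b = (X i).val) ∧ (∀ i : Fin 2, (y' i).val / b = 0)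
          then f (x' - y') else 0) * (torusChar q X).re
      ≤ ∑ q ∈ IR, (b : ℝ) ^ 2 * (A / N q + (b : ℝ) ^ 2 * D) := sum_le_sum hq_bound
    _ = (b : ℝ) ^ 2 * A * ∑ q ∈ IR, 1 / N q + (b : ℝ) ^ 4 * D * IR.card := by
        have hterm : ∀ q : TorusSite 2 m, (b : ℝ) ^ 2 * (A / N q + (b : ℝ) ^ 2 * D) =
            (b : ℝ) ^ 2 * A * (1 / N q) + (b : ℝ) ^ 4 * D := fun q => by ring
        simp_rw [hterm]
        rw [sum_add_distrib, sum_const, nsmul_eq_mul, ← mul_sum]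
        ring
    _ ≤ (b : ℝ) ^ 2 * A * (8 * (J : ℝ)) + (b : ℝ) ^ 4 * D * ((2 * (J : ℝ) + 1) ^ 2 - 1) := by
        refine add_le_add (mul_le_mul_of_nonneg_left hsumN (by positivity))
          (mul_le_mul_of_nonneg_left hcardIR (by positivity))
    _ ≤ (b : ℝ) ^ 2 * A * (8 * R) + (b : ℝ) ^ 4 * D * ((2 * R + 1) ^ 2 - 1) := by
        have hJ0 : (0 : ℝ) ≤ J := Nat.cast_nonneg _
        refine add_le_add (mul_le_mul_of_nonneg_left (by linarith) (by positivity))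
          (mul_le_mul_of_nonneg_left ?_ (by positivity))
        nlinarith
    _ = 4 / π * (b : ℝ) ^ 2 * κ₀ * M * m * Real.sqrt (C / 8) +
        (b : ℝ) ^ 4 * Real.sqrt (C / (1 - Real.cos ((2 * π - κ₀) / b))) *
          ((κ₀ * m / π) ^ 2 + 2 * (κ₀ * m / π)) := by
        rw [hA, hD, hcb, hR]
        field_simp
        ring

end Sharp

end TorusBlock

end Literature.Probability.LatticeModels

end
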